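import Summits.MatrixMultiplication.OmegaCensus.STPPVosperSlackTwoCheckersSound

/-!
# ω-census (abelian STPP census): the slack-2 case-C checker — named leaf and control-flow exhaustiveness (kernel tool)

HONEST FRAMING (pub-omega census; verbatim): lottery ticket; floor = certified bounds/negative ranges.
Census STRUCTURE (seat pub-omega-stpp-1 gen 32, 2026-08-28), family (b2).  The case-C analogue of `STPPVosperSlackTwoCheckers.lean` §9: the leaf of
`caseCDeadQP` NAMED (`caseCLeaf`), the checker over the named leaf (`caseCDeadQP'`, definitionally equal to `caseCDeadQP`), and the two control-flow
lemmas the soundness proof consumes — `realisationsDead_of_caseCLeaf` (inside the leaf: every interval position `z0`, admissible hole, `Y°`-sublist with the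
right sumset mask reaches the realisation stage) and `caseCLeaf_of_caseCDeadQP'` (the tiling loop reaches every admissible tiling, by `tilesAll_complete`).
What remains for case C (successor): the normal-form and reduction lemmas (as `STPPVosperSlackTwoSoundA.lean` / `…SoundAReduce.lean` for case A, using
`slack_two_caseC_HR_A/_B`).  UNCONDITIONAL; no `decide`.  Nothing here is progress on `ω`.

References: H. Cohn, R. Kleinberg, B. Szegedy, C. Umans, FOCS 2005 (arXiv:math/0511460), Def. 5.1; Y. O. Hamidoune, Ø. J. Rødseth, Acta Arith. 92 (2000).
-/

namespace Summit.MatrixMultiplication.OmegaCensus.CubeNB.S2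

open Summit.MatrixMultiplication.OmegaCensus.CubeNB.Bits

/-- The leaf of the case-C loop, NAMED (same text as inside `caseCDeadQP`). [cite: CohnKleinbergSzegedyUmans2005, Def. 5.1] -/
def caseCLeaf (p L z a₀ b₀ c₀ : ℕ) (Q P : List ℕ) (R : List ℕ) (cov : ℕ) : Bool :=
  let is := List.range p
  let b := Q.length
  let free := fullMask p ^^^ cov
  let zc := Q.foldl (fun m q => m &&& rot p free q) (fullMask p)
  (List.range p).all fun z0 =>
    let ivl := (List.range (z + 1)).map fun t => (z0 + t) % p
    let miss := ivl.filter fun x => !(tb zc x)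
    !(Nat.ble miss.length 1) ||
      (cond (Nat.beq miss.length 0) ivl miss).all fun hx =>
        let Zo := ivl.filter fun x => !(Nat.beq x hx)
        let tM := Q.foldl (fun m q => m ||| rot p (maskOf Zo) (p - q)) 0
        !(Nat.beq (popc is tM) (b + z)) ||
          (let sy := free ^^^ tM
           let yc := P.foldl (fun m x => m &&& rot p sy x) (fullMask p)
           !(Nat.ble L (popc is yc)) ||
             ((members is yc).sublistsLen L).all fun Yo =>
               let syM := P.foldl (fun m x => m ||| rot p (maskOf Yo) (p - x)) 0
               !(Nat.beq syM sy) || realisationsDead p a₀ b₀ c₀ P Q R Yo Zo)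

/-- Case C over the named leaf. [cite: CohnKleinbergSzegedyUmans2005, Def. 5.1] -/
def caseCDeadQP' (p c L z a₀ b₀ c₀ : ℕ) (Q P : List ℕ) : Bool :=
  let patt := pattPQ p P Q
  !(decide patt.Nodup) ||
    (let masks := transMasks p patt
     let T0 := (masks.headD (0, 0)).2
     let rest := masks.drop 1
     tilesAll (caseCLeaf p L z a₀ b₀ c₀ Q P) (c - 1) rest [0] T0)

/-- The two spellings agree (definitionally). [folklore] -/
theorem caseCDeadQP'_eq (p c L z a₀ b₀ c₀ : ℕ) (Q P : List ℕ) : caseCDeadQP' p c L z a₀ b₀ c₀ Q P = caseCDeadQP p c L z a₀ b₀ c₀ Q P := rfl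

/-- **The case-C leaf is exhaustive.**  If `caseCLeaf … R cov = true` then for every interval position `z0 < p` with at most one of its `z + 1` points
outside the candidate mask, every admissible hole `hx` (the missing point if there is one, else any point), provided the sumset mask `tM` of
`Z° = interval ∖ {hx}` has `b + z` members, and every `L`-sublist `Yo` of the `Y`-candidates whose sumset mask is exactly `sy = free ∖ tM`, the
realisation stage is dead. [cite: CohnKleinbergSzegedyUmans2005, Def. 5.1] -/
theorem realisationsDead_of_caseCLeaf {p L z a₀ b₀ c₀ : ℕ} {Q P R : List ℕ} {cov : ℕ}
    (h : caseCLeaf p L z a₀ b₀ c₀ Q P R cov = true) (z0 : ℕ) (hz0 : z0 < p)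
    (hmiss : (((List.range (z + 1)).map fun t => (z0 + t) % p).filter fun x =>
      !(tb (Q.foldl (fun m q => m &&& rot p (fullMask p ^^^ cov) q) (fullMask p)) x)).length ≤ 1)
    (hx : ℕ)
    (hhx : hx ∈ cond (Nat.beq (((List.range (z + 1)).map fun t => (z0 + t) % p).filter fun x =>
        !(tb (Q.foldl (fun m q => m &&& rot p (fullMask p ^^^ cov) q) (fullMask p)) x)).length 0)
      ((List.range (z + 1)).map fun t => (z0 + t) % p)
      (((List.range (z + 1)).map fun t => (z0 + t) % p).filter fun x =>
        !(tb (Q.foldl (fun m q => m &&& rot p (fullMask p ^^^ cov) q) (fullMask p)) x)))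
    (htM : popc (List.range p) (Q.foldl (fun m q => m ||| rot p
      (maskOf (((List.range (z + 1)).map fun t => (z0 + t) % p).filter fun x => !(Nat.beq x hx))) (p - q)) 0) = Q.length + z)
    (Yo : List ℕ)
    (hYo : Yo ∈ (members (List.range p) (P.foldl (fun m x => m &&& rot p ((fullMask p ^^^ cov) ^^^ Q.foldl (fun m q => m ||| rot p
      (maskOf (((List.range (z + 1)).map fun t => (z0 + t) % p).filter fun x => !(Nat.beq x hx))) (p - q)) 0) x) (fullMask p))).sublistsLen L)
    (hsyM : P.foldl (fun m x => m ||| rot p (maskOf Yo) (p - x)) 0 = (fullMask p ^^^ cov) ^^^ Q.foldl (fun m q => m ||| rot p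
      (maskOf (((List.range (z + 1)).map fun t => (z0 + t) % p).filter fun x => !(Nat.beq x hx))) (p - q)) 0) :
    realisationsDead p a₀ b₀ c₀ P Q R Yo (((List.range (z + 1)).map fun t => (z0 + t) % p).filter fun x => !(Nat.beq x hx)) = true := by
  unfold caseCLeaf at h
  simp only [List.all_eq_true, Bool.or_eq_true, Bool.not_eq_true'] at h
  rcases h z0 (List.mem_range.2 hz0) with h | h
  · rw [Nat.ble_eq_true_of_le hmiss] at h; exact Bool.noConfusion h
  rcases h hx hhx with h | h
  · rw [htM, Nat.beq_refl] at h; exact Bool.noConfusion h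
  rcases h with h | h
  · have hle := (List.mem_sublistsLen.1 hYo).1.length_le
    rw [(List.mem_sublistsLen.1 hYo).2, ← popc_eq_length_members] at hle
    rw [Nat.ble_eq_true_of_le hle] at h; exact Bool.noConfusion h
  rcases h Yo hYo with h | h
  · rw [hsyM, Nat.beq_refl] at h; exact Bool.noConfusion h
  · exact h

/-- **Case C is exhaustive** (outer loop): if `caseCDeadQP' … Q P = true` and the pattern `P + Q` is duplicate-free, then the leaf holds at every
sequentially admissible choice of `c − 1` further translates. [cite: CohnKleinbergSzegedyUmans2005, Def. 5.1] -/
theorem caseCLeaf_of_caseCDeadQP' {p c L z a₀ b₀ c₀ : ℕ} {Q P : List ℕ} (h : caseCDeadQP' p c L z a₀ b₀ c₀ Q P = true)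
    (hpatt : (pattPQ p P Q).Nodup) (rs : List (ℕ × ℕ)) (hsub : rs.Sublist ((transMasks p (pattPQ p P Q)).drop 1)) (hlen : rs.length = c - 1)
    (hadm : admissible ((transMasks p (pattPQ p P Q)).headD (0, 0)).2 rs = true) :
    caseCLeaf p L z a₀ b₀ c₀ Q P ([0] ++ rs.map Prod.fst) (rs.foldl (fun cv x => cv ||| x.2) ((transMasks p (pattPQ p P Q)).headD (0, 0)).2) = true := by
  unfold caseCDeadQP' at h
  simp only [hpatt, decide_true, Bool.not_true, Bool.false_or] at h
  by_contra hleaf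
  rw [Bool.not_eq_true] at hleaf
  have key := tilesAll_complete (caseCLeaf p L z a₀ b₀ c₀ Q P) _ rs [0] _ hsub hadm hleaf
  rw [hlen, h] at key
  exact Bool.noConfusion key

end Summit.MatrixMultiplication.OmegaCensus.CubeNB.S2
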